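import Literature.MathematicalPhysics.QuantumFieldTheory.Balaban1983to89.T3MinimiserStabilityReduction
import Literature.MathematicalPhysics.QuantumFieldTheory.Balaban1983to89.T3PrintedRegularMinimiser
import Literature.MathematicalPhysics.QuantumFieldTheory.Balaban1983to89.T3OrbitAverage
import Literature.MathematicalPhysics.QuantumFieldTheory.Balaban1983to89.B12ContinuousTransportInvariance
import Literature.MathematicalPhysics.QuantumFieldTheory.Balaban1983to89.Node00.CanonicalTransportOfRecord
import Literature.MathematicalPhysics.QuantumFieldTheory.Balaban1983to89.T3InteriorExcision
import Summits.QuantumFields.YangMills.Theorems.FluctuationComparisonRegPrIntLSupTailReduction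
import Summits.QuantumFields.YangMills.Theorems.FluctuationComparisonRegPrIntLSupTailDepthInduction
import Summits.QuantumFields.YangMills.Theorems.FluctuationComparisonRegPrIntLWreg
import HarnessLib

/-!
# LINE g22-3 «plaquette_tail» — THE GAUSSIAN PLAQUETTE TAIL: MSTEP∘ (hence MSTEP₁∘ and DEEPSTEP∘, LINE g22-1∕g22-2's tail stubs) from ONE per-plaquette row with the
# printed rate `e^{−κ·p(g_j)²}`, the torus volume discharged by kernel-checked arithmetic (ideator `ym-r3-idea-1` g22, LENS «control»)

Crux of record: `stmt-QuantumFields-20520` = `Summit.QuantumFields.YangMills.Theses.UnitScaleTilt.FluctuationComparisonRegPrIntL`.  Targets concluded BY NAME here: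
MSTEP∘ `MultiStepTailIntCan`, MSTEP₁∘ `OneStepTailIntCan`, DEEPSTEP∘ `DeepStepTailIntCan` — the texts of LINE g22-1 `Lines/multistep_odds.lean` §2 (l.262–321)
BYTE-IDENTICAL (= LINE g22-2 `Lines/persistence_floor.lean` §1), bridges `Iff.rfl`.  MSTEP₁∘ and DEEPSTEP∘ are the two tail STUBS shared by g22-1 (`largeFieldFourPtIntCan_
of_stubs`) and g22-2 (`goodHistoryPositiveIntCan_of_stubs`); with this file both are discharged to ONE new row PLAQTAIL∘, so the organ LFR♯ᶜ∘ rests on 1L4ᶜ∘, H4ᶜ∘,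
CRUDELOC, PERS₁∘, PLAQTAIL∘ (5 rows).  Registry FROZEN (RULING №36∕37∕39): PUBLISHED organ-level line, NOT registered; no `skeleton check` from this seat.

THE LEVER (lens «control» — the controlling quantity is Bałaban's `p(g)² − log Vol`).  MSTEP∘ asks a SUP over all plaquettes of the free level `j` with an abstract
super-polynomially small rate `s_j` chosen after `F` (the torus exponent `F.m` is free, so no `F`-uniform rate exists).  Two things are mixed in it: (a) a LOCAL
estimate — the conditional probability, given an interior level-`J` event, that ONE plaquette `p` of level `j` is `θ_j(b₀)`-large — which is what cluster ∕ RG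
expansions deliver, with the PRINTED rate `e^{−κ·p(g_j)²}` ([Balaban1985UV3] (7): «`p(g) = b₀(1 + log g⁻¹)^{p₀}` … `e^{−p(g_k)²}` is smaller than any power of
`g_k`»; [Balaban1989LargeFieldII] (1.77)–(1.79): a factor `exp(−c·p(g_k)²)` per large-field cube); (b) the ENTROPY of the torus, `#Plaq_j = 9·(2L^{F.m+j})³`, and the
arithmetic that `p(g_j)² ≥ b₀²(1 + ½·j·log L)²` beats `3j·log L + 3F.m·log L` for EVERY `b₀ > 0` as soon as `p₀ ≥ 1` — which is exactly why the rows carry the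
threshold `pS ≤ p₀` and no threshold on `b₀`.  This file separates them: PLAQTAIL∘ is (a) alone (one plaquette, explicit rate, uniform in `J < j ≤ K`, all runs);
(b) is PROVED (§3): ✓`card_plaq_le` (`#Plaq_j ≤ 9·(2L^{F.m+j})³`, from `Plaq ↪ Site × Fin 3 × Fin 3`, `ZMod.card`), ✓`one_add_log_inv_coupling_ge` (`1 + log g_j⁻¹ ≥
1 + ½·j·log L` for `γ ≤ 1`), ✓`pFun_sq_ge` (`p(g_j)² ≥ ¼b₀²(log L)²·j²` for `p₀ ≥ 1`, `Real.rpow_le_rpow_of_exponent_le`), ✓`superpoly_geom_gauss` (`(j+1)^a·C·B^j·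
e^{−ηj²} → 0`), and the union bound over the plaquettes of level `j` (✓`multiStepTail_of_plaqTail`, `measure_iUnion_fintype_le`).  At depth one the interior price
lives in `κ = κ(L, c)` (deviation `θ_{J+1}(1 − c∕c_max(L))` in the linearised toy, FL-B); at depth `≥ 2` the background is invisible at plaquette precision
(`C_k(L)·c·θ_J·L^{−2k} ≪ θ_j`, FL-2 letters L1–L3 of the g22-1 card) — ONE row serves all depths because the rate form `e^{−κ p(g_j)²}` absorbs both.
WHY NOT «background + fluctuation» as two rows: at depth `≥ 2` a background-location row (printed [Balaban1985Variational] Thm 1 (8)) plus a fluctuation row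
RELATIVE to the background is a costume — the background's level-`j` plaquettes are `o(θ_j)`, so the relative row is DEEPSTEP∘ again at a halved window (recorded
dead end, NOTES); the honest cut is local-versus-entropy, made here.

THE LINE.  MSTEP∘ ⟸ (PROVED §4) PLAQTAIL∘ `PlaquetteGaussTailIntCan` (NEW); MSTEP₁∘, DEEPSTEP∘ ⟸ MSTEP∘ (restriction, PROVED).  STUB (1, §5): PLAQTAIL∘.  Concluders
`multiStepTailIntCan_of_stubs`, `oneStepTailIntCan_of_stubs`, `deepStepTailIntCan_of_stubs`.  `lean check`: rc 0, sorries = the 1 stub, 0 elsewhere.  ONE-STUB SHAPE,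
declared: the line REPLACES two shared stubs by one strictly more local row plus checked arithmetic; it is not a split and does not pretend to be.

HONEST STATUS.  Nothing of Bałaban's is asserted; R3-FLIN ∕ FL-B ∕ FL-N ∕ FL-2 are toy letters (GUIDANCE); PLAQTAIL∘ ∕ MSTEP₁∘ ∕ DEEPSTEP∘ ∕ POS∘ ∕ PERS₁∘ ∕ LFR♯ᶜ∘ ∕
S2β ∕ 20520 are NOT proved; `YM3TorusSU2` is NOT proved; rung R3 — NOT d = 4, NOT infinite volume, NOT a mass gap, NOT Clay; no summit is proved by a line.
References: [Balaban1985UV3] (3) p.256, (7) p.257, (38)–(41) p.266; [Balaban1989LargeFieldII] (1.77)–(1.79) p.383; [Balaban1988Convergent] (1.4) p.247;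
[Balaban1985Averaging] (5) p.18, (10) p.19; [Balaban1987RG1] (0.1) p.251, (0.18) p.255.
-/

open MeasureTheory Filter Topology Set
open scoped ENNReal NNReal BigOperators
open Literature.MathematicalPhysics.QuantumFieldTheory.Balaban1983to89
open Literature.MathematicalPhysics.QuantumFieldTheory.Balaban1983to89.T3ContinuumYM3Torus
open Literature.MathematicalPhysics.QuantumFieldTheory.Balaban1983to89.T3NestedUnitLaws
open Literature.MathematicalPhysics.QuantumFieldTheory.Balaban1983to89.T3UnitLawDensityEML
open Literature.MathematicalPhysics.QuantumFieldTheory.Balaban1983to89.T3UnitScaleTilt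
open Literature.MathematicalPhysics.QuantumFieldTheory.Balaban1983to89.T3TiltDescent
open Literature.MathematicalPhysics.QuantumFieldTheory.Balaban1983to89.T3PrintedRegularMinimiser
open Literature.MathematicalPhysics.QuantumFieldTheory.Balaban1983to89.T3ConstrainedMinimiser (fibre)
open Literature.MathematicalPhysics.QuantumFieldTheory.Balaban1983to89.T3LevelShift
open Literature.MathematicalPhysics.QuantumFieldTheory.Balaban1983to89.Missing
open Literature.MathematicalPhysics.QuantumFieldTheory.Balaban1983to89.T4Continuum
open Literature.MathematicalPhysics.QuantumFieldTheory.Balaban1983to89.T3DescentFibreTower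
open scoped Literature.MathematicalPhysics.QuantumFieldTheory.Balaban1983to89.T3OrbitAverage
open Literature.MathematicalPhysics.QuantumFieldTheory.Balaban1983to89.T3InteriorExcision (θBal_mul θBal_mul_le)
open Summit.QuantumFields.YangMills.Theorems.FluctuationComparisonRegPrIntLWregAssembly (isOpen_setOf_plaqSmall₂)
open Summit.QuantumFields.YangMills.Theorems.FluctuationComparisonRegPrIntLOddsLedgerVers (tower_eq_map_descendTo)
open Summit.QuantumFields.YangMills.Theorems.FluctuationComparisonRegPrIntLSupTailReduction (le_on_of_ae_le heightDensityCan_le_of_setwise heightDensityCan_univ_eqOn)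
open Summit.QuantumFields.YangMills.Theorems.FluctuationComparisonRegPrIntLSupTailDepthInduction (mem_histGood_iff_descendTo)


noncomputable section

namespace Summit.QuantumFields.YangMills.Cruxes.FluctuationComparisonRegPrIntL.RunPairOrgan.PlaquetteTail

/-! ## §1 ROWS OF RECORD, VERBATIM (LINE g22-1 `Lines/multistep_odds.lean` §2 l.262–321): the TARGETS MSTEP∘, MSTEP₁∘, DEEPSTEP∘ -/

section Rows

variable (F : T3Family) (γ b₀ p₀ ε₀ : ℝ) {J K : ℕ} (hJK : J ≤ K)

/-- **MSTEP∘ · PER-LEVEL CONDITIONAL TAIL AFTER ONE INTERIOR CONDITIONING** (`MultiStepTailIntCan`): there is a super-polynomially small `s : ℕ → ℝ≥0` (chosen AFTER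
`F, γ` — the torus exponent `F.m` is free, so only eventual smallness is asked) such that for every run `K`, every window level `J ≤ K`, every FREE level `J < j ≤ K`
and every measurable `B` inside the INTERIOR level-`J` window: `Gibbs_K(D_{J,K}⁻¹B ∩ {level j of the run leaves W_j(b₀)}) ≤ s_j·Gibbs_K(D_{J,K}⁻¹B)` — the
conditional probability, given an interior level-`J` event, that the `(j − J)`-STEP constrained fluctuation above it has a `θ_j(b₀)`-large plaquette.  The mechanism:
the `(j−J)`-step background (iterated fibre minimiser) of an interior datum lies inside `W_j(b₀)` with room `≍ θ_j` (de-averaging ratio `C_{j−J}(L)∕L^{2(j−J)}`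
against `L^{−(j−J)∕2}`), and the fluctuation around it is sub-Gaussian at scale `β_j^{−1∕2} ≪ θ_j`; entropy `Vol_j` is beaten by `e^{−cβ_jθ_j²} = e^{−c′L^j p(g_j)²∕…}`
for `j` large, whence super-polynomial `s`.  PROVED below from MSTEP₁∘ (`j = J+1`) and DEEPSTEP∘ (`j ≥ J+2`).  WHY IT MIGHT FAIL: through its two halves.
[cite: Balaban1985UV3, (38)-(40) p.266; Balaban1985Averaging, (10) p.19 and Prop. 1; Balaban1985Variational, Thm 1 (9)-(10) p.279] -/
def MultiStepTailIntCan : Prop :=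
  ∀ (L : ℕ), ∃ c₀ : ℝ, 0 < c₀ ∧ c₀ ≤ 1 ∧ ∀ (c : ℝ), 0 < c → c ≤ c₀ → ∃ pS : ℝ, ∀ (b₀ p₀ : ℝ), 0 < b₀ → pS ≤ p₀ → 0 < p₀ →
    ∃ γ₁ : ℝ, 0 < γ₁ ∧ ∀ (F : T3Family) (γ : ℝ), F.L = L → 0 < γ → γ ≤ γ₁ →
      ∃ s : ℕ → ℝ, (∀ j, 0 ≤ s j) ∧ (∀ a : ℕ, Tendsto (fun j : ℕ => ((j : ℝ) + 1) ^ a * s j) atTop (𝓝 0)) ∧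
        ∀ (J j K : ℕ) (hJK : J ≤ K) (hjK : j ≤ K), J < j →
          ∀ (B : Set (GaugeField (F.P J) 0 (Matrix.specialUnitaryGroup (Fin 2) ℂ))), MeasurableSet B →
            B ⊆ {U | PlaqSmall (θBal F.L γ (c * b₀) p₀ J) U} →
            gibbsK F ℰp γ K (descendTo F ℰp J K hJK ⁻¹' B ∩
                {V | ¬ PlaqSmall (θBal F.L γ b₀ p₀ j) (descendTo F ℰp j K hjK V)}) ≤
              ENNReal.ofReal (s j) * gibbsK F ℰp γ K (descendTo F ℰp J K hJK ⁻¹' B)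

/-- **MSTEP₁∘ · THE DEPTH-ONE ABSOLUTE TAIL — INTERIOR WINDOW, ALL RUNS, FAR FIELDS INCLUDED** (`OneStepTailIntCan`): MSTEP∘ at the first free level `j = J + 1`:
given an interior level-`J` event, the run's level `J + 1` leaves `W_{J+1}(b₀)` with conditional probability `≤ s_{J+1}`, uniformly in `K ≥ J + 1`.  On the interior
the good history is TYPICAL in the fibre, so the natural statement is ABSOLUTE (no division by the good-history mass): the re-typed home of MOD₁∘ (moderate fields,
`Lines/tailsup_one.lean` §4e) AND of the suspended FAR₁ (critic #405 (A), decision (ii)); the moderate∕far split at a fixed `δ₀` is the hands' internal choice, served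
by the LEAD's boxes D `…TailSupOneGaussianTail` (sub-Gaussian sup tail + union bound) and H `…TailSupOneFarPlaquetteCost` (`β_{J+1}(dist δ₀)²∕2` per far plaquette),
with E `…TailSupOneFibreRows` ∕ G `…ComparisonDoor` for the push-forward to the one-step fibre.  WHY IT MIGHT FAIL: the interior price — in the linearised toy the
fibre minimiser of an interior datum stays inside `W_{J+1}(b₀)` iff `c < c_max(L) = L^{3∕2}∕C(L)` (`0.602` at L = 3, `0.926` at L = 5; FL-B j337570∕j337675); the
NONLINEAR SU(2) one-cell constant may differ by `O(θ²)` (instrument ASK (8)); and for `K > J + 1` the level-`(J+1)` marginal of the fibre measure is the one-step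
fibre law tilted by the deeper effective density, whose flatness across `W_{J+1}` (WREG-type input) is used. [cite: Balaban1985UV3, (38)-(40) p.266;
Balaban1985Averaging, (10) p.19 and Prop. 1; Balaban1985Variational, Thm 1 (8)-(10) p.279] -/
def OneStepTailIntCan : Prop :=
  ∀ (L : ℕ), ∃ c₀ : ℝ, 0 < c₀ ∧ c₀ ≤ 1 ∧ ∀ (c : ℝ), 0 < c → c ≤ c₀ → ∃ pS : ℝ, ∀ (b₀ p₀ : ℝ), 0 < b₀ → pS ≤ p₀ → 0 < p₀ →
    ∃ γ₁ : ℝ, 0 < γ₁ ∧ ∀ (F : T3Family) (γ : ℝ), F.L = L → 0 < γ → γ ≤ γ₁ →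
      ∃ s : ℕ → ℝ, (∀ j, 0 ≤ s j) ∧ (∀ a : ℕ, Tendsto (fun j : ℕ => ((j : ℝ) + 1) ^ a * s j) atTop (𝓝 0)) ∧
        ∀ (J K : ℕ) (hJK : J + 1 ≤ K)
          (B : Set (GaugeField (F.P J) 0 (Matrix.specialUnitaryGroup (Fin 2) ℂ))), MeasurableSet B →
            B ⊆ {U | PlaqSmall (θBal F.L γ (c * b₀) p₀ J) U} →
            gibbsK F ℰp γ K (descendTo F ℰp J K ((Nat.le_succ J).trans hJK) ⁻¹' B ∩
                {V | ¬ PlaqSmall (θBal F.L γ b₀ p₀ (J + 1)) (descendTo F ℰp (J + 1) K hJK V)}) ≤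
              ENNReal.ofReal (s (J + 1)) * gibbsK F ℰp γ K (descendTo F ℰp J K ((Nat.le_succ J).trans hJK) ⁻¹' B)

/-- **DEEPSTEP∘ · THE MULTI-STEP TAILS `j ≥ J + 2` — INTERIOR WINDOW, ALL RUNS** (`DeepStepTailIntCan`): MSTEP∘ at the free levels two or more steps above the
window: the `k`-STEP (`k = j − J ≥ 2`) constrained fluctuation above an interior level-`J` event has a `θ_j(b₀)`-large plaquette with conditional probability `≤ s_j`.
THE NEW OBJECT: the `k`-step de-averaging constant `C_k(L) := sup ‖ω ↦ d(k-step joint fibre minimiser)‖_{∞→∞}·L^{2k}` (linearised), conjecturally `≈ C(L^k) ≤ 15`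
(R3-FLIN: `C(9) = 14.1`), to be compared with `L^{3k∕2}·Ππ` (`= 27` for `k = 2, L = 3`): the window ratio decays like `L^{−k∕2}` while the background's plaquettes decay
like `L^{−2k}` — the margin IMPROVES with depth and needs NO interior fraction from `k = 2` on.  WHY IT MIGHT FAIL: (i) if the iterated averaging `ℰp∘ℰp` is NOT the
block-`L²` averaging (composition defect of the printed `ℰp`), `C₂(3)` is a genuinely new number — instrument row R3-FLIN-2STEP (ASK, sealed prediction `C₂(3) ∈
[11, 17]`; kill `≥ 27`); (ii) for `K > j` the level-`j` marginal of the fibre measure is tilted by the deeper effective density (WREG-type flatness used); (iii) the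
uniformity in `k` of the sub-Gaussian constants (entropy `Vol_j` vs `e^{−cL^{j}…}`) is routine only once (i)–(ii) hold. [cite: Balaban1985Averaging, (10) p.19 and
Prop. 1; Balaban1985Variational, Thm 1 (9)-(10) p.279 and Prop. 7 p.299; Balaban1985UV3, (38)-(40) p.266] -/
def DeepStepTailIntCan : Prop :=
  ∀ (L : ℕ), ∃ c₀ : ℝ, 0 < c₀ ∧ c₀ ≤ 1 ∧ ∀ (c : ℝ), 0 < c → c ≤ c₀ → ∃ pS : ℝ, ∀ (b₀ p₀ : ℝ), 0 < b₀ → pS ≤ p₀ → 0 < p₀ →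
    ∃ γ₁ : ℝ, 0 < γ₁ ∧ ∀ (F : T3Family) (γ : ℝ), F.L = L → 0 < γ → γ ≤ γ₁ →
      ∃ s : ℕ → ℝ, (∀ j, 0 ≤ s j) ∧ (∀ a : ℕ, Tendsto (fun j : ℕ => ((j : ℝ) + 1) ^ a * s j) atTop (𝓝 0)) ∧
        ∀ (J j K : ℕ) (hJK : J ≤ K) (hjK : j ≤ K), J + 2 ≤ j →
          ∀ (B : Set (GaugeField (F.P J) 0 (Matrix.specialUnitaryGroup (Fin 2) ℂ))), MeasurableSet B →
            B ⊆ {U | PlaqSmall (θBal F.L γ (c * b₀) p₀ J) U} →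
            gibbsK F ℰp γ K (descendTo F ℰp J K hJK ⁻¹' B ∩
                {V | ¬ PlaqSmall (θBal F.L γ b₀ p₀ j) (descendTo F ℰp j K hjK V)}) ≤
              ENNReal.ofReal (s j) * gibbsK F ℰp γ K (descendTo F ℰp J K hJK ⁻¹' B)


/-! ## §2 THE NEW ROW: PLAQTAIL∘ — ONE plaquette of the free level, the printed rate `e^{−κ·p(g_j)²}`, all runs, all depths `j > J` -/

/-- **PLAQTAIL∘ · THE GAUSSIAN PLAQUETTE TAIL AFTER ONE INTERIOR CONDITIONING** (`PlaquetteGaussTailIntCan`): after the shared-shape prefix and `F, γ` there are `κ > 0`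
and a prefactor `A` such that for every run `K`, every window level `J ≤ K`, every free level `J < j ≤ K`, every measurable `B` inside the INTERIOR level-`J` window
`W_J(c·b₀)` and every SINGLE plaquette `p` of level `j`: `Gibbs_K(D_{J,K}⁻¹B ∩ {|U_j(∂p) − 1| ≥ θ_j(b₀)}) ≤ A·e^{−κ·p(g_j)²}·Gibbs_K(D_{J,K}⁻¹B)`, where `U_j = D_{j,K}U` is the
run's level `j`, `g_j = √(γL^{−j})` and `p(g) = b₀(1 + log g⁻¹)^{p₀}` (so `θ_j(b₀) = g_j·p(g_j)` = ✓`θBal`).  This is the LOCAL large-field estimate of the inductive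
RG step — one plaquette variable of the `(j−J)`-step constrained fluctuation above an interior datum is `θ_j`-large with conditional probability `≲ e^{−κβ_jθ_j²} =
e^{−κ p(g_j)²}` — in print the factor `exp(−c p(g_k)²)` carried by every large-field cube ([Balaban1989LargeFieldII] (1.77)–(1.79); [Balaban1988Convergent] (1.4));
the torus volume is NOT in this row (it is discharged by ✓`multiStepTail_of_plaqTail`).  Depth one: the interior price sits in `κ = κ(L, c)` — the one-step background
of an edge-of-`W_J(c b₀)` datum has level-`(J+1)` plaquettes `≈ (c∕c_max(L))·θ_{J+1}`, so the deviation to pay is `θ_{J+1}(1 − c∕c_max(L))` (FL-B: `c_max(3) = 0.602`,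
`c_max(5) = 0.926`); depth `k ≥ 2`: the background is `C_k(L)·c·θ_J·L^{−2k} ≪ θ_j` (FL-2 letters).  WHY IT MIGHT FAIL: (i) the rate is GAUSSIAN IN `p(g_j)` up to
the threshold `θ_j` only if the conditional fibre law is sub-Gaussian at scale `g_j` for single-plaquette functionals uniformly in the datum (interior) and in
`K ≥ j` — for `K > j` the level-`j` marginal is tilted by the deeper effective density (UV stability (7) on small fields; large fields of deeper levels must be
summed with their own `e^{−p(g)²}` factors: an induction on `K − j` is hidden here); (ii) at depth one with `c` close to `c_max(L)` the constant `κ(L,c) → 0` — allowed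
(`κ` after `c`), but the nonlinear SU(2) one-cell constant may shift `c_max` by `O(θ²)`; (iii) a prefactor `A` independent of `j` requires the per-plaquette bound
without hidden polynomial factors in `β_j` (they would be absorbed by lowering `κ`, since `p(g)² ≫ log β`). [cite: Balaban1985UV3, (7) p.257 and (38)-(40) p.266;
Balaban1989LargeFieldII, (1.77)-(1.79) p.383; Balaban1988Convergent, (1.4) p.247] -/
def PlaquetteGaussTailIntCan : Prop :=
  ∀ (L : ℕ), ∃ c₀ : ℝ, 0 < c₀ ∧ c₀ ≤ 1 ∧ ∀ (c : ℝ), 0 < c → c ≤ c₀ → ∃ pS : ℝ, ∀ (b₀ p₀ : ℝ), 0 < b₀ → pS ≤ p₀ → 0 < p₀ →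
    ∃ γ₁ : ℝ, 0 < γ₁ ∧ ∀ (F : T3Family) (γ : ℝ), F.L = L → 0 < γ → γ ≤ γ₁ →
      ∃ κ A : ℝ, 0 < κ ∧
        ∀ (J j K : ℕ) (hJK : J ≤ K) (hjK : j ≤ K), J < j →
          ∀ (B : Set (GaugeField (F.P J) 0 (Matrix.specialUnitaryGroup (Fin 2) ℂ))), MeasurableSet B →
            B ⊆ {U | PlaqSmall (θBal F.L γ (c * b₀) p₀ J) U} →
            ∀ p : Plaq (F.P j) 0,
              gibbsK F ℰp γ K (descendTo F ℰp J K hJK ⁻¹' B ∩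
                  {V | θBal F.L γ b₀ p₀ j ≤ dist1 (GaugeField.plaqHol (descendTo F ℰp j K hjK V) p)}) ≤
                ENNReal.ofReal (A * Real.exp (-(κ * (B10.pFun b₀ p₀ (Real.sqrt (γ * ((F.L : ℝ)⁻¹) ^ j))) ^ 2))) *
                  gibbsK F ℰp γ K (descendTo F ℰp J K hJK ⁻¹' B)

end Rows

/-! ## §3 PROVED: the entropy of the torus against `e^{−κ p(g_j)²}` — Bałaban's remark after (7), kernel-checked for the tree's `θBal` ∕ `pFun` -/

section Arithmetic

/-- **THE PLAQUETTE COUNT OF LEVEL `j`**: `#Plaq_j ≤ 9·(2L^{F.m+j})³` (`Plaq ↪ Site × Fin 3 × Fin 3`, `#Site = (2L^{m+j})³`). [cite: Balaban1987RG1, (0.1) p.251; Balaban1985Averaging, (5) p.18] -/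
theorem card_plaq_le (F : T3Family) (j : ℕ) : (Fintype.card (Plaq (F.P j) 0) : ℝ) ≤ 9 * (2 * (F.L : ℝ) ^ (F.m + j)) ^ 3 := by
  classical
  have hinj : Function.Injective fun p : Plaq (F.P j) 0 => (p.src, p.μ, p.ν) := by
    intro p q h
    obtain ⟨ps, pμ, pν, _⟩ := p
    obtain ⟨qs, qμ, qν, _⟩ := q
    simp only [Prod.mk.injEq] at h
    obtain ⟨h1, h2, h3⟩ := h
    subst h1 h2 h3
    rfl
  have hcard := Fintype.card_le_of_injective _ hinj
  have hsite : Fintype.card (Site (F.P j) 0) = (2 * F.L ^ (F.m + j)) ^ 3 := by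
    have h1 : Fintype.card (Site (F.P j) 0) = Fintype.card (Fin (F.P j).d → ZMod ((F.P j).sitesPerDir 0)) := rfl
    rw [h1, Fintype.card_fun, ZMod.card, Fintype.card_fin, T3Family.P_d]
    have h2 : (F.P j).sitesPerDir 0 = 2 * F.L ^ (F.m + j) := by
      simp only [Params.sitesPerDir, Nat.sub_zero]
      rfl
    rw [h2]
  have hprod : Fintype.card (Site (F.P j) 0 × (Fin (F.P j).d × Fin (F.P j).d)) = (2 * F.L ^ (F.m + j)) ^ 3 * 9 := by
    rw [Fintype.card_prod, Fintype.card_prod, Fintype.card_fin, T3Family.P_d, hsite]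
  rw [hprod] at hcard
  have : (Fintype.card (Plaq (F.P j) 0) : ℝ) ≤ ((2 * F.L ^ (F.m + j)) ^ 3 * 9 : ℕ) := by exact_mod_cast hcard
  simpa [mul_comm] using this

/-- **THE LOGARITHM OF THE RUNNING COUPLING**: for `0 < γ ≤ 1`, `1 < L` and `g_j = √(γL^{−j})`: `0 < g_j` and `1 + log g_j⁻¹ ≥ 1 + ½·j·log L`. [cite: Balaban1985UV3, (3) p.256 and (7) p.257] -/
theorem one_add_log_inv_coupling_ge {L : ℕ} (hL : 1 < L) {γ : ℝ} (hγ : 0 < γ) (hγ1 : γ ≤ 1) (j : ℕ) :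
    0 < Real.sqrt (γ * ((L : ℝ)⁻¹) ^ j) ∧
      1 + (j : ℝ) * Real.log L / 2 ≤ 1 + Real.log (Real.sqrt (γ * ((L : ℝ)⁻¹) ^ j))⁻¹ := by
  have hL0 : (0 : ℝ) < L := by exact_mod_cast (zero_lt_one.trans hL)
  have hLi : (0 : ℝ) < ((L : ℝ)⁻¹) ^ j := pow_pos (inv_pos.2 hL0) j
  have hx : 0 < γ * ((L : ℝ)⁻¹) ^ j := mul_pos hγ hLi
  refine ⟨Real.sqrt_pos.2 hx, ?_⟩
  have hlog : Real.log (Real.sqrt (γ * ((L : ℝ)⁻¹) ^ j))⁻¹ = -(Real.log γ + (j : ℝ) * Real.log ((L : ℝ)⁻¹)) / 2 := by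
    rw [Real.log_inv, Real.log_sqrt hx.le, Real.log_mul hγ.ne' hLi.ne', Real.log_pow]
    ring
  have hγlog : Real.log γ ≤ 0 := Real.log_nonpos hγ.le hγ1
  rw [hlog, Real.log_inv]
  have : 0 ≤ (j : ℝ) * Real.log L := mul_nonneg (Nat.cast_nonneg _) (Real.log_nonneg (by exact_mod_cast hL.le))
  linarith

/-- **`p(g_j)²` GROWS QUADRATICALLY IN `j`** for every `b₀ > 0` once `p₀ ≥ 1`: `¼·b₀²(log L)²·j² ≤ p(g_j)²`. [cite: Balaban1985UV3, (7) p.257] -/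
theorem pFun_sq_ge {L : ℕ} (hL : 1 < L) {γ b₀ p₀ : ℝ} (hγ : 0 < γ) (hγ1 : γ ≤ 1) (hb : 0 < b₀) (hp : 1 ≤ p₀) (j : ℕ) :
    b₀ ^ 2 * Real.log L ^ 2 / 4 * (j : ℝ) ^ 2 ≤ (B10.pFun b₀ p₀ (Real.sqrt (γ * ((L : ℝ)⁻¹) ^ j))) ^ 2 := by
  obtain ⟨-, hge⟩ := one_add_log_inv_coupling_ge hL hγ hγ1 j
  set x : ℝ := 1 + Real.log (Real.sqrt (γ * ((L : ℝ)⁻¹) ^ j))⁻¹ with hxdef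
  have hlogL : 0 ≤ Real.log L := Real.log_nonneg (by exact_mod_cast hL.le)
  have hjl : 0 ≤ (j : ℝ) * Real.log L / 2 := by positivity
  have hx1 : 1 ≤ x := by linarith
  have hxp : x ≤ x ^ p₀ := by
    calc x = x ^ (1 : ℝ) := (Real.rpow_one x).symm
      _ ≤ x ^ p₀ := Real.rpow_le_rpow_of_exponent_le hx1 hp
  have hpF : B10.pFun b₀ p₀ (Real.sqrt (γ * ((L : ℝ)⁻¹) ^ j)) = b₀ * x ^ p₀ := rfl
  have hlow : b₀ * ((j : ℝ) * Real.log L / 2) ≤ b₀ * x ^ p₀ := mul_le_mul_of_nonneg_left (by linarith) hb.le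
  have h0 : 0 ≤ b₀ * ((j : ℝ) * Real.log L / 2) := mul_nonneg hb.le hjl
  calc b₀ ^ 2 * Real.log L ^ 2 / 4 * (j : ℝ) ^ 2 = (b₀ * ((j : ℝ) * Real.log L / 2)) ^ 2 := by ring
    _ ≤ (b₀ * x ^ p₀) ^ 2 := pow_le_pow_left₀ h0 hlow 2
    _ = _ := by rw [hpF]

/-- **A GAUSSIAN IN `j` BEATS ANY GEOMETRIC GROWTH, SUPER-POLYNOMIALLY**: `(j+1)^a·C·B^j·e^{−ηj²} → 0` for `C ≥ 0`, `B ≥ 1`, `η > 0`. [folklore] -/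
theorem superpoly_geom_gauss {C B η : ℝ} (hC : 0 ≤ C) (hB : 1 ≤ B) (hη : 0 < η) (a : ℕ) :
    Tendsto (fun j : ℕ => ((j : ℝ) + 1) ^ a * (C * B ^ j * Real.exp (-(η * (j : ℝ) ^ 2)))) atTop (𝓝 0) := by
  have hB0 : 0 < B := zero_lt_one.trans_le hB
  -- the majorant `C·e^{−j}`
  have hmaj : Tendsto (fun j : ℕ => C * Real.exp (-(j : ℝ))) atTop (𝓝 0) := by
    have h := (Real.tendsto_exp_neg_atTop_nhds_zero.comp tendsto_natCast_atTop_atTop).const_mul C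
    simpa using h
  refine squeeze_zero' (Eventually.of_forall fun j => by positivity) ?_ hmaj
  obtain ⟨j₀, hj₀⟩ : ∃ j₀ : ℕ, ((a : ℝ) + Real.log B + 1) / η ≤ j₀ := exists_nat_ge _
  refine eventually_atTop.2 ⟨j₀, fun j hj => ?_⟩
  have hjR : (j₀ : ℝ) ≤ j := by exact_mod_cast hj
  have hηj : (a : ℝ) + Real.log B + 1 ≤ η * j := by
    have := (div_le_iff₀ hη).1 (hj₀.trans hjR)
    linarith [this]
  have hj0 : (0 : ℝ) ≤ j := Nat.cast_nonneg j
  -- `(j+1)^a ≤ e^{a j}`, `B^j = e^{j log B}`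
  have h1 : ((j : ℝ) + 1) ^ a ≤ Real.exp ((a : ℝ) * j) := by
    calc ((j : ℝ) + 1) ^ a ≤ (Real.exp (j : ℝ)) ^ a := pow_le_pow_left₀ (by positivity) (Real.add_one_le_exp _) a
      _ = Real.exp ((a : ℝ) * j) := by rw [← Real.exp_nat_mul]
  have h2 : B ^ j = Real.exp ((j : ℝ) * Real.log B) := by
    rw [Real.exp_nat_mul, Real.exp_log hB0]
  have hexp : Real.exp ((a : ℝ) * j) * Real.exp ((j : ℝ) * Real.log B) * Real.exp (-(η * (j : ℝ) ^ 2)) ≤ Real.exp (-(j : ℝ)) := by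
    rw [← Real.exp_add, ← Real.exp_add, Real.exp_le_exp]
    nlinarith [hηj, hj0]
  calc ((j : ℝ) + 1) ^ a * (C * B ^ j * Real.exp (-(η * (j : ℝ) ^ 2)))
      = C * (((j : ℝ) + 1) ^ a * B ^ j * Real.exp (-(η * (j : ℝ) ^ 2))) := by ring
    _ ≤ C * (Real.exp ((a : ℝ) * j) * Real.exp ((j : ℝ) * Real.log B) * Real.exp (-(η * (j : ℝ) ^ 2))) := by
        rw [h2]
        exact mul_le_mul_of_nonneg_left (mul_le_mul_of_nonneg_right (mul_le_mul_of_nonneg_right h1 (Real.exp_nonneg _)) (Real.exp_nonneg _)) hC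
    _ ≤ C * Real.exp (-(j : ℝ)) := mul_le_mul_of_nonneg_left hexp hC

end Arithmetic

/-! ## §4 PROVED: MSTEP∘ ⟸ PLAQTAIL∘ (union bound over the plaquettes of the free level + §3), and the two restrictions -/

section Door

/-- ★★★ **MSTEP∘ ⟸ PLAQTAIL∘** (PROVED).  `pS := max pS 1` (so `p₀ ≥ 1`), `γ₁ := min γ₁ 1`; given `F, γ`: `s_j := #Plaq_j·|A|·e^{−κ p(g_j)²}`; the bad event of level `j`
is the union over its plaquettes of the single-plaquette events (`PlaqSmall` is a `∀ p`), `measure_iUnion_fintype_le`, PLAQTAIL∘ per plaquette, `Finset.sum_const`;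
super-polynomial smallness of `s` by ✓`card_plaq_le`, ✓`pFun_sq_ge`, ✓`superpoly_geom_gauss` with `C = 72·L^{3F.m}·|A|`, `B = L³`, `η = ¼κb₀²(log L)²`.
[cite: Balaban1985UV3, (7) p.257 and (38)-(40) p.266; Balaban1989LargeFieldII, (1.77)-(1.79) p.383] -/
theorem multiStepTail_of_plaqTail : PlaquetteGaussTailIntCan → MultiStepTailIntCan := by
  intro hP L
  obtain ⟨c₀, hc₀, hc₀1, H⟩ := hP L
  refine ⟨c₀, hc₀, hc₀1, fun c hc hcle => ?_⟩
  obtain ⟨pS, H⟩ := H c hc hcle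
  refine ⟨max pS 1, fun b₀ p₀ hb hpS hp => ?_⟩
  have hp1 : 1 ≤ p₀ := (le_max_right _ _).trans hpS
  obtain ⟨γ₁, hγ₁, H⟩ := H b₀ p₀ hb ((le_max_left _ _).trans hpS) hp
  refine ⟨min γ₁ 1, lt_min hγ₁ one_pos, fun F γ hFL hγ hγle => ?_⟩
  have hγ1 : γ ≤ 1 := hγle.trans (min_le_right _ _)
  have hL : 1 < F.L := F.hL.2
  obtain ⟨κ, A, hκ, H⟩ := H F γ hFL hγ (hγle.trans (min_le_left _ _))
  -- the rate and the plaquette count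
  set r : ℕ → ℝ := fun j => |A| * Real.exp (-(κ * (B10.pFun b₀ p₀ (Real.sqrt (γ * ((F.L : ℝ)⁻¹) ^ j))) ^ 2)) with hr
  set N : ℕ → ℝ := fun j => (Fintype.card (Plaq (F.P j) 0) : ℝ) with hN
  have hr0 : ∀ j, 0 ≤ r j := fun j => mul_nonneg (abs_nonneg _) (Real.exp_nonneg _)
  have hN0 : ∀ j, 0 ≤ N j := fun j => Nat.cast_nonneg _
  refine ⟨fun j => N j * r j, fun j => mul_nonneg (hN0 j) (hr0 j), fun a => ?_, ?_⟩
  · -- super-polynomial smallness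
    have hL1 : (1 : ℝ) ≤ F.L := by exact_mod_cast hL.le
    have hL0 : (0 : ℝ) ≤ F.L := zero_le_one.trans hL1
    set C : ℝ := 72 * (F.L : ℝ) ^ (3 * F.m) * |A| with hC
    set Bg : ℝ := (F.L : ℝ) ^ 3 with hBg
    set η : ℝ := κ * (b₀ ^ 2 * Real.log F.L ^ 2 / 4) with hη
    have hC0 : 0 ≤ C := by positivity
    have hBg1 : 1 ≤ Bg := one_le_pow₀ hL1
    have hlogL : 0 < Real.log F.L := Real.log_pos (by exact_mod_cast hL)
    have hη0 : 0 < η := by positivity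
    have hbound : ∀ j : ℕ, N j * r j ≤ C * Bg ^ j * Real.exp (-(η * (j : ℝ) ^ 2)) := by
      intro j
      have hNj : N j ≤ 9 * (2 * (F.L : ℝ) ^ (F.m + j)) ^ 3 := card_plaq_le F j
      have hvol : 9 * (2 * (F.L : ℝ) ^ (F.m + j)) ^ 3 = 72 * (F.L : ℝ) ^ (3 * F.m) * Bg ^ j := by
        rw [hBg, ← pow_mul, pow_add, mul_pow, mul_pow, ← pow_mul, ← pow_mul]; ring_nf
      have hrj : r j ≤ |A| * Real.exp (-(η * (j : ℝ) ^ 2)) := by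
        refine mul_le_mul_of_nonneg_left (Real.exp_le_exp.2 ?_) (abs_nonneg _)
        have hq := pFun_sq_ge hL hγ hγ1 hb hp1 j
        rw [hη]
        nlinarith [hq, hκ.le]
      calc N j * r j ≤ (72 * (F.L : ℝ) ^ (3 * F.m) * Bg ^ j) * (|A| * Real.exp (-(η * (j : ℝ) ^ 2))) := by
            rw [← hvol]; exact mul_le_mul hNj hrj (hr0 j) (by positivity)
        _ = C * Bg ^ j * Real.exp (-(η * (j : ℝ) ^ 2)) := by rw [hC]; ring
    refine squeeze_zero' (Eventually.of_forall fun j => mul_nonneg (by positivity) (mul_nonneg (hN0 j) (hr0 j)))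
      (Eventually.of_forall fun j => mul_le_mul_of_nonneg_left (hbound j) (by positivity)) (superpoly_geom_gauss hC0 hBg1 hη0 a)
  · -- the union bound over the plaquettes of level `j`
    intro J j K hJK hjK hJj B hB hBW
    set μ := gibbsK F ℰp γ K with hμ
    set D := descendTo F ℰp J K hJK ⁻¹' B with hD
    have hsub : D ∩ {V | ¬ PlaqSmall (θBal F.L γ b₀ p₀ j) (descendTo F ℰp j K hjK V)} ⊆
        ⋃ p : Plaq (F.P j) 0, (D ∩ {V | θBal F.L γ b₀ p₀ j ≤ dist1 (GaugeField.plaqHol (descendTo F ℰp j K hjK V) p)}) := by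
      rintro V ⟨hVD, hVbad⟩
      simp only [Set.mem_setOf_eq, PlaqSmall, not_forall, not_lt] at hVbad
      obtain ⟨p, hp⟩ := hVbad
      exact Set.mem_iUnion.2 ⟨p, hVD, hp⟩
    have hone : ∀ p : Plaq (F.P j) 0,
        μ (D ∩ {V | θBal F.L γ b₀ p₀ j ≤ dist1 (GaugeField.plaqHol (descendTo F ℰp j K hjK V) p)}) ≤ ENNReal.ofReal (r j) * μ D := by
      intro p
      refine (H J j K hJK hjK hJj B hB hBW p).trans (mul_le_mul_right' (ENNReal.ofReal_le_ofReal ?_) _)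
      exact mul_le_mul_of_nonneg_right (le_abs_self A) (Real.exp_nonneg _)
    calc μ (D ∩ {V | ¬ PlaqSmall (θBal F.L γ b₀ p₀ j) (descendTo F ℰp j K hjK V)})
        ≤ μ (⋃ p : Plaq (F.P j) 0, (D ∩ {V | θBal F.L γ b₀ p₀ j ≤ dist1 (GaugeField.plaqHol (descendTo F ℰp j K hjK V) p)})) :=
          measure_mono hsub
      _ ≤ ∑ p : Plaq (F.P j) 0, μ (D ∩ {V | θBal F.L γ b₀ p₀ j ≤ dist1 (GaugeField.plaqHol (descendTo F ℰp j K hjK V) p)}) :=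
          measure_iUnion_fintype_le μ _
      _ ≤ ∑ _p : Plaq (F.P j) 0, ENNReal.ofReal (r j) * μ D := Finset.sum_le_sum fun p _ => hone p
      _ = (Fintype.card (Plaq (F.P j) 0) : ℝ≥0∞) * (ENNReal.ofReal (r j) * μ D) := by
          rw [Finset.sum_const, Finset.card_univ, nsmul_eq_mul]
      _ = ENNReal.ofReal (N j * r j) * μ D := by
          rw [ENNReal.ofReal_mul (hN0 j), hN, ENNReal.ofReal_natCast, mul_assoc]

/-- MSTEP₁∘ is MSTEP∘ at the first free level. [cite: Balaban1985UV3, (38)-(40) p.266] -/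
theorem oneStepTail_of_multiStep : MultiStepTailIntCan → OneStepTailIntCan := by
  intro hM L
  obtain ⟨c₀, hc₀, hc₀1, H⟩ := hM L
  refine ⟨c₀, hc₀, hc₀1, fun c hc hcle => ?_⟩
  obtain ⟨pS, H⟩ := H c hc hcle
  refine ⟨pS, fun b₀ p₀ hb hpS hp => ?_⟩
  obtain ⟨γ₁, hγ₁, H⟩ := H b₀ p₀ hb hpS hp
  refine ⟨γ₁, hγ₁, fun F γ hFL hγ hγle => ?_⟩
  obtain ⟨s, hs0, hst, H⟩ := H F γ hFL hγ hγle
  exact ⟨s, hs0, hst, fun J K hJK B hB hBW => H J (J + 1) K ((Nat.le_succ J).trans hJK) hJK (Nat.lt_succ_self J) B hB hBW⟩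

/-- DEEPSTEP∘ is MSTEP∘ at the free levels `j ≥ J + 2`. [cite: Balaban1985UV3, (38)-(40) p.266] -/
theorem deepStepTail_of_multiStep : MultiStepTailIntCan → DeepStepTailIntCan := by
  intro hM L
  obtain ⟨c₀, hc₀, hc₀1, H⟩ := hM L
  refine ⟨c₀, hc₀, hc₀1, fun c hc hcle => ?_⟩
  obtain ⟨pS, H⟩ := H c hc hcle
  refine ⟨pS, fun b₀ p₀ hb hpS hp => ?_⟩
  obtain ⟨γ₁, hγ₁, H⟩ := H b₀ p₀ hb hpS hp
  refine ⟨γ₁, hγ₁, fun F γ hFL hγ hγle => ?_⟩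
  obtain ⟨s, hs0, hst, H⟩ := H F γ hFL hγ hγle
  exact ⟨s, hs0, hst, fun J j K hJK hjK hJj B hB hBW => H J j K hJK hjK (by omega) B hB hBW⟩

end Door

/-! ## §5 THE STUB (1: PLAQTAIL∘, new) and the by-name concluders (MSTEP∘; the shared stubs MSTEP₁∘ and DEEPSTEP∘ of LINES g22-1∕g22-2) -/

/-- STUB (NEW) · PLAQTAIL∘. -/
theorem stub_plaquetteGaussTailIntCan : PlaquetteGaussTailIntCan := by
  sorry

/-- ★ BY-NAME CONCLUDER: MSTEP∘ `MultiStepTailIntCan` (LINE g22-1 §2 text) from the one stub. -/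
theorem multiStepTailIntCan_of_stubs : MultiStepTailIntCan :=
  multiStepTail_of_plaqTail stub_plaquetteGaussTailIntCan

/-- ★ BY-NAME CONCLUDER: MSTEP₁∘ `OneStepTailIntCan` (stub of LINES g22-1∕g22-2, text byte-identical). -/
theorem oneStepTailIntCan_of_stubs : OneStepTailIntCan :=
  oneStepTail_of_multiStep multiStepTailIntCan_of_stubs

/-- ★ BY-NAME CONCLUDER: DEEPSTEP∘ `DeepStepTailIntCan` (stub of LINES g22-1∕g22-2, text byte-identical). -/
theorem deepStepTailIntCan_of_stubs : DeepStepTailIntCan :=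
  deepStepTail_of_multiStep multiStepTailIntCan_of_stubs

end Summit.QuantumFields.YangMills.Cruxes.FluctuationComparisonRegPrIntL.RunPairOrgan.PlaquetteTail

end
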